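import Mathlib
import HarnessLib
import Literature.NumberTheory.LFunctions.ZetaZeros
import Literature.Analysis.SpecialFunctions.DigammaVerticalSeries

/-!
# RH-FREE — «nothing here bears on the truth of RH»: a finite Guinand–Weil dictionary and the archimedean tail order for the truncated Weil quadratic form (Groskin 2026, arXiv:2607.02828: Lemmas 2.1, 2.2, 2.3, 3.1; Theorems 2.5, 3.2; Corollary 3.3), typed AS PRINTED as claims of an unrefereed preprint

Topic `Literature/NumberTheory/LFunctions` (namespace `Literature.NumberTheory.LFunctions`; the
paper's objects in the sub-namespace `Groskin2026`). STATEMENT LAYER (D-0014), cell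
`rh-columns/lit`, tranche 1; the Weil-positivity column (D-0040 (ii)) cites Corollary 3.3 in
`Summits/RiemannHypothesis/RiemannHypothesis/Theses/WeilComb.lean`. Source:

* **[Gr26]** A. Groskin, *A finite Guinand–Weil dictionary and archimedean tail order for the
  truncated Weil quadratic form*, arXiv:2607.02828v3 (14 Aug 2026), 15 pp. + ancillary verification
  package. UNREFEREED (D-0012): every statement the source proves is a
  `[claim: Groskin2026, status: under-review]`, consumed as a hypothesis, never asserted. Held:
  `paper:arxiv-2607.02828` (locators = PDF pages). "Use of AI tools. Language-model tools were used
  as a drafting and verification-tooling assistant under the author's direction" (p. 13). This file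
  records STATEMENTS and two cheap kernel facts; it endorses nothing. "The paper does not prove RH,
  Weil positivity, a prime-location bound, a next-prime theorem, or a factoring result" (p. 13).

## What the source prints

§2.1 (p. 3–4). Fix `c > 1`, `L = log c`, `Δ = L/2π`, `ρ = 2π/L`, `N ≥ 0`. A real even-sector vector
`v = (v₀,…,v_N)` is embedded as `u₀ = v₀`, `u_k = u_{−k} = v_k/√2` (`1 ≤ k ≤ N`) on `I_N = {−N,…,N}`;
`T_v(t) = Σ_{m=−N}^{N} u_m e^{2πimt}`; `K_v(ω) = 2∫₀^ω T_v(t) T_v(ω−t) dt` (Volterra sine-chord kernel);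
`ĝ_v(ξ) = π K_v(1 − |ξ|/Δ)` for `|ξ| ≤ Δ`, `0` otherwise; `g_v(z) = ∫_{−Δ}^{Δ} ĝ_v(ξ) e^{2πizξ} dξ`. For a
`C¹` source `ψ`, `(Q_ψ)_{mn} = (ψ(m) − ψ(n))/(m − n)` (`m ≠ n`), `ψ′(m)` (`m = n`) on `I_N` ("exactly the
structure of [Connes–van Suijlekom, Prop. 4.1]"), and `⟨v, Q_ψ v⟩ = Σ_{m,n} u_m u_n (Q_ψ)_{mn}`. Sources:
(1) `ψ_p^{(c)}(x) = −(1/π) Σ_{q=p^a≤c} Λ(q)/√q · sin(2πx(1 − log q/L))`,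
(2) `ψ₀(x) = (1/π)∫₀^L 2cosh(y/2) sin(2πx(1 − y/L)) dy`,
(3) `ψ_{R,T}(x) = (1/2π²)∫_{−T}^{T} h₊(r) S(r,x,L) dr`, `S(r,x,L) = ∫₀^L sin(2πx(1 − y/L)) cos(ry) dy`,
`h₊(r) = Re ψ_Γ(¼ + ir/2) − log π`; `Q_prime := Q_{ψ_p}`, `Q_pole := Q_{ψ₀}`, `Q_arch,T := Q_{ψ_{R,T}}`,
`Q_arch,∞ := lim_{T→∞} Q_arch,T` (entrywise, Lemma 2.1), `Q_∞ := Q_prime + Q_pole + Q_arch,∞` (4).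

* **Lemma 2.1** (p. 4). The limit defining `Q_arch,∞` exists entrywise, and `Q_∞` is the
  Connes–Consani–Moscovici Galerkin matrix of the Weil form; in the proof:
  `(Q_pole)_{mn} = 32L sinh²(L/4)(L² − 16π²mn)/((L² + 16π²m²)(L² + 16π²n²))`.
* **Lemma 2.2** (p. 4). `g_v` is entire of exponential type `≤ L`, `ĝ_v` is supported in `[−Δ,Δ]`,
  and `g_v(z) = O((1 + |Re z|)⁻²)` uniformly on every horizontal strip.
* **Lemma 2.3** (p. 5). For `ψ_{α,ω}(x) = (α/π) sin(2πωx)`: `⟨v, Q_{α,ω} v⟩ = α K_v(ω)`.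
* **Theorem 2.5** (p. 6). `⟨v, Q_∞ v⟩ = Σ_{z ∈ Z*_ζ} g_v(z)`, `Z*_ζ = {z : ½ + iz is a nontrivial zero
  of ζ}`, with multiplicity; equivalently
  `⟨v, Q_∞ v⟩ = −(1/π)Σ_{q=p^a≤c} Λ(q)/√q ĝ_v(log q/2π) + 2g_v(i/2) + (1/2π)∫_ℝ h₊(r) g_v(r) dr`.
* **Lemma 3.1** (p. 9). `h₊` is strictly increasing on `(0,∞)`, with
  `h₊′(t) = (t/2)Σ_{k≥0} (k + ¼)/((k + ¼)² + (t/2)²)² ≤ 1/t + 13/(10t²)` (`t > 0`); "Interval evaluation in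
  Arb gives `h₊(7) = 0.10717967… > 0`, so `h₊(t) > 0` for `t ≥ 7`"; `h₊(t) ≤ log t − 8/5` (`t ≥ 7`).
* §3 (p. 8): for `T > ρN`, `a_T = T/ρ`, `p_T(n) = 1/(a_T − n)`, `q_T(n) = 1/(a_T + n)` (`n ∈ I_N`).
* **Theorem 3.2** (p. 10). For `T₂ > T₁ > max(ρN, 7)`, `Δ_{T₁,T₂} := Q_arch,T₂ − Q_arch,T₁ =
  (1/π²)∫_{T₁}^{T₂} h₊(T) sin²(LT/2) ρ⁻¹ (p_T p_Tᵗ + q_T q_Tᵗ) dT`; `Δ_{T₁,T₂}` is positive definite on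
  `ℂ^{I_N}` (hence on the real even subspace); every minor with increasing row and column sets is `> 0`.
* **Corollary 3.3** (p. 11). `Q_T^tot := Q_prime + Q_pole + Q_arch,T`,
  `B_T := (1/π²)∫_T^∞ h₊(r) sin²(Lr/2) ρ⁻¹ (‖p_r‖₂² + ‖q_r‖₂²) dr`. For `T > max(ρN, 7)`:
  (i) `Q_∞ − Q_T^tot ≻ 0` and `0 ⪯ Q_∞ − Q_T^tot ⪯ B_T I`, hence
  `λ_j(Q_T^tot) < λ_j(Q_∞) ≤ λ_j(Q_T^tot) + B_T`; (ii) decision rule: `λ_j(Q_T^tot) ≥ 0` certifies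
  `λ_j(Q_∞) > 0`; `λ_j(Q_T^tot) < −B_T` certifies `λ_j(Q_∞) < 0`; (iii) for `N ≥ 1`,
  `B_T ≤ (2(2N+1)ρ/π²)(log T/(T − ρN) + (ρN)⁻¹ log(T/(T − ρN)))`, and
  `B_T = ((2N+1)ρ/(π²T))(log(T/2π) + 1)(1 + o(1))` as `T → ∞`; "in particular `B_{2T}/B_T → ½`".

## Lean rendering

* Index set `I_N` = the `Finset` `Finset.Icc (−N) N ⊂ ℤ` coerced to a type (as in the tree's
  `ConnesVanSuijlekom.sectionMatrix`); matrices are `Matrix (idx N) (idx N) ℝ`; the diagonal of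
  `dividedDiffMatrix ψ N` is Mathlib's `deriv ψ m` (the sources are smooth). `⟨v, Q v⟩` is
  `quadValue N v Q = u ⬝ᵥ (Q *ᵥ u)`, `u = evenEmbed N v`.
* `h₊ = hPlus` is `reDigammaQuarter r − log π` over the tree's
  `Literature.Analysis.SpecialFunctions.reDigammaQuarter r = Re ψ(¼ + ir/2)` (Mathlib `Complex.digamma`).
* `Q_arch,∞` is `Matrix.of (limUnder atTop …)` entrywise (junk-free exactly when Lemma 2.1 holds;
  the claim `lemma_2_1_limit` is stated with `Tendsto`, not with `limUnder`).
* Zeros: the tree's `ZetaZeros.riemannZetaNontrivialZeros` with multiplicity `riemannZetaZeroOrder`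
  (`ZetaZeros.lean`); `z = (ρ − ½)/i`; the zero sum is a `HasSum` over the subtype (absolute
  convergence as printed, Lemma 2.2). `Λ = ArithmeticFunction.vonMangoldt`, summed over all
  `q ≤ ⌊c⌋` (it vanishes off prime powers).
* Positive (semi)definiteness and `⪯ B_T I` are Mathlib's `Matrix.PosDef` / `PosSemidef` over `ℝ`
  (for a real symmetric matrix this is equivalent to the printed statement on `ℂ^{I_N}`); the
  eigenvalue sandwich of (i) is recorded in this Loewner form (from which it follows by Weyl/
  Courant–Fischer, as printed); "increasing row and column sets" = `StrictMono` index maps.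

## Proved here (cheap kernel consequences)

`hPlus_seven_pos` — the paper's Arb certificate `h₊(7) > 0` REPLAYED IN THE KERNEL from the tree's
vertical series (`sum_digammaTerm_le`, ten terms) and `re_digamma_one_quarter_sub_log_pi_ge`;
`hPlus_pos_of_seven_le` (`h₊ > 0` on `[7,∞)`, with the tree's `reDigammaQuarter_mono`);
`hPlus_mono` (non-strict monotonicity on `[0,∞)`); `corollary_3_3_certify_pos` /
`corollary_3_3_certify_neg` (the two halves of the decision rule (ii), from claim (i)).

## Proved elsewhere in this tree (cross-references as of 2026-08-27; all RH-FREE, axioms standard)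

EVERY claim of this file is DISCHARGED by a theorem `Groskin2026.<claim>_holds` in a sibling proof
file (the defs below are unchanged; users' `(h : <claim>)` are fed `<claim>_holds`):
`lemma_2_1_limit_holds`, `corollary_3_3_i_holds` (`TruncatedWeilFormArchTailProofs.lean`);
`lemma_2_1_pole_holds` (`TruncatedWeilFormTailOrderPoleProofs.lean`); `lemma_2_2_holds`
(`TruncatedWeilFormTestFunctionProofs.lean`); `lemma_2_3_holds` (`TruncatedWeilFormTailOrderProofs.lean`);
`theorem_2_5_holds` (`TruncatedWeilFormZeroSideProofs.lean`, on `theorem_2_5'_holds`,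
`TruncatedWeilFormArchSideProofs.lean`, whose prime and pole sides are in
`TruncatedWeilFormSourceSideProofs.lean`); `lemma_3_1_holds` (`TruncatedWeilFormTailOrderDensityProofs.lean`);
`theorem_3_2_holds` (`TruncatedWeilFormTailDensityRepr.lean`, with `TruncatedWeilFormTailMinorsProofs.lean`);
`corollary_3_3_iii_holds` (`TruncatedWeilFormTailBudgetProofs.lean`) — cells `rh-crit/cc` and
`rh-columns/lit`, 2026-08-26/27. The items this file leaves untyped are typed AND proved elsewhere:
Lemma 2.1, second clause (`Q_∞^{(c,N)}` = the Connes–Consani–Moscovici matrix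
`ConnesConsani2025.truncatedWeilMatrix (log c) N`: `Groskin2026.cutoffFreeMatrix_eq_truncatedWeilMatrix`,
with the claim `Groskin2026.lemma_2_1_arch` discharged in `TruncatedWeilFormArchBlockProofs.lean`) and
Corollary 2.7 (`Groskin2026.corollary_2_7`, discharged in `TruncatedWeilFormVolterraDomainProofs.lean`
via `…PoleNeutralProofs`, `…VolterraKernelRigidity`, `…FiniteDictionaryProofs`) in
`TruncatedWeilFormFiniteDictionary.lean`; Lemma 2.3's measure form and Corollary 2.4 (finite source
quotient), proved, in `TruncatedWeilFormSourceQuotient.lean`. Still not typed: the numerical §§2.3, 4.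

## Status note (one paragraph, no endorsement)

[Gr26] (v3, 14 Aug 2026; v1 July 2026) is an unrefereed arXiv preprint with a released numerical
package (exact/symbolic audits, Arb interval certificates); its two theorems are finite, exact
statements about the Connes–van Suijlekom / Connes–Consani–Moscovici truncation at fixed `(c, N)`:
Theorem 2.5 is Weil's explicit formula applied to the explicitly transported band-limited test
function `g_v` (Remark 2.6: "the content … is the exact closed-form transport"), and Theorem 3.2 /
Corollary 3.3 say that the omitted archimedean tail past `T > max(ρN, 7)` is a positive definite,
totally positive Cauchy–Stieltjes increment of trace `B_T ~ (2N+1)ρ log T/(π²T)`, so finite-cutoff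
positivity certifies cutoff-free positivity while a finite-cutoff negative eigenvalue in `[−B_T, 0)`
certifies nothing (the correction of the author's earlier arXiv:2605.20224 computation, p. 2). The
entry-level identification of `Q_∞` with the CCM assembly (Lemma 2.1, second clause), Corollary 2.4
(source quotient), Corollary 2.7 (pole-neutral family, `dim = N − s − 1`) and the numerical §§2.3, 4
are NOT typed here. Nothing here bears on the truth of RH.
-/

noncomputable section

open Filter Set MeasureTheory Complex Finset Matrix
open scoped Real Topology

namespace Literature.NumberTheory.LFunctions

namespace Groskin2026

open Literature.Analysis.SpecialFunctions

/-! ## §2.1 The finite objects -/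

/-- The frequency index set `I_N = {−N, …, N} ⊂ ℤ` ([Gr26] §2.1). [cite: Groskin2026, §2.1 (p. 3)] -/
def idx (N : ℕ) : Finset ℤ := Finset.Icc (-(N : ℤ)) N

/-- Membership in `I_N` bounds the absolute value. [cite: Groskin2026, §2.1 (p. 3)] -/
theorem natAbs_le_of_mem_idx {N : ℕ} {m : ℤ} (h : m ∈ idx N) : m.natAbs ≤ N := by
  simp only [idx, Finset.mem_Icc] at h
  omega

/-- The isometric even-sector embedding `u₀ = v₀`, `u_k = u_{−k} = v_k/√2` (`1 ≤ k ≤ N`) of a real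
vector `v = (v₀,…,v_N)` ([Gr26] §2.1). [cite: Groskin2026, §2.1 (p. 3)] -/
def evenEmbed (N : ℕ) (v : Fin (N + 1) → ℝ) : idx N → ℝ := fun m ↦
  if (m : ℤ) = 0 then v 0
  else v ⟨(m : ℤ).natAbs, Nat.lt_succ_of_le (natAbs_le_of_mem_idx m.2)⟩ / Real.sqrt 2

/-- The finite divided-difference matrix of a source `ψ` on `I_N`:
`(Q_ψ)_{mn} = (ψ(m) − ψ(n))/(m − n)` for `m ≠ n` and `ψ′(m)` on the diagonal ([Gr26] §2.1;
Connes–van Suijlekom Prop. 4.1). [cite: Groskin2026, §2.1 (p. 3)] -/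
def dividedDiffMatrix (ψ : ℝ → ℝ) (N : ℕ) : Matrix (idx N) (idx N) ℝ :=
  Matrix.of fun m n ↦
    if (m : ℤ) = n then deriv ψ m else (ψ m - ψ n) / ((m : ℤ) - (n : ℤ) : ℝ)

/-- The even-sector contraction `⟨v, Q v⟩ = Σ_{m,n ∈ I_N} u_m u_n Q_{mn}`, `u = evenEmbed N v`
([Gr26] §2.1). [cite: Groskin2026, §2.1 (p. 3)] -/
def quadValue (N : ℕ) (v : Fin (N + 1) → ℝ) (Q : Matrix (idx N) (idx N) ℝ) : ℝ :=
  evenEmbed N v ⬝ᵥ (Q *ᵥ evenEmbed N v)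

/-- `T_v(t) = Σ_{m=−N}^{N} u_m e^{2πimt}` ([Gr26] §2.1). [cite: Groskin2026, §2.1 (p. 3)] -/
def trigPoly (N : ℕ) (v : Fin (N + 1) → ℝ) (t : ℝ) : ℂ :=
  ∑ m : idx N, (evenEmbed N v m : ℂ) * cexp (2 * π * I * ((m : ℤ) : ℂ) * t)

/-- The Volterra sine-chord kernel `K_v(ω) = 2∫₀^ω T_v(t) T_v(ω − t) dt` ([Gr26] §2.1).
[cite: Groskin2026, §2.1 (p. 3)] -/
def volterraKernel (N : ℕ) (v : Fin (N + 1) → ℝ) (ω : ℝ) : ℂ :=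
  2 * ∫ t in (0 : ℝ)..ω, trigPoly N v t * trigPoly N v (ω - t)

/-- `Δ = L/2π = log c/2π` ([Gr26] §2.1). [cite: Groskin2026, §2.1 (p. 3)] -/
def bandwidth (c : ℝ) : ℝ := Real.log c / (2 * π)

/-- `ρ = 2π/L` ([Gr26] §2.1). [cite: Groskin2026, §2.1 (p. 3)] -/
def rho (c : ℝ) : ℝ := 2 * π / Real.log c

/-- The induced Fourier weight `ĝ_v(ξ) = π K_v(1 − |ξ|/Δ)` for `|ξ| ≤ Δ`, `0` for `|ξ| > Δ`
([Gr26] §2.1). [cite: Groskin2026, §2.1 (p. 3)] -/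
def fourierWeight (c : ℝ) (N : ℕ) (v : Fin (N + 1) → ℝ) (ξ : ℝ) : ℂ :=
  if |ξ| ≤ bandwidth c then π * volterraKernel N v (1 - |ξ| / bandwidth c) else 0

/-- The induced test function `g_v(z) = ∫_{−Δ}^{Δ} ĝ_v(ξ) e^{2πizξ} dξ` (`z ∈ ℂ`) ([Gr26] §2.1).
[cite: Groskin2026, §2.1 (p. 3)] -/
def testFunction (c : ℝ) (N : ℕ) (v : Fin (N + 1) → ℝ) (z : ℂ) : ℂ :=
  ∫ ξ in (-bandwidth c)..bandwidth c, fourierWeight c N v ξ * cexp (2 * π * I * z * ξ)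

/-- The archimedean density `h₊(r) = Re ψ_Γ(¼ + ir/2) − log π` ([Gr26] §2.1, after (3)), over the
tree's `reDigammaQuarter`. [cite: Groskin2026, §2.1 (p. 4)] -/
def hPlus (r : ℝ) : ℝ := reDigammaQuarter r - Real.log π

/-- The prime source (1): `ψ_p^{(c)}(x) = −(1/π) Σ_{q = p^a ≤ c} Λ(q) q^{-1/2} sin(2πx(1 − log q/L))`
(`Λ` vanishes off prime powers, so the sum runs over all `q ≤ ⌊c⌋`). [cite: Groskin2026, §2.1 eq. (1) (p. 3)] -/
def primeSource (c : ℝ) (x : ℝ) : ℝ :=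
  -(1 / π) * ∑ q ∈ Finset.range (⌊c⌋₊ + 1),
    (ArithmeticFunction.vonMangoldt q) / Real.sqrt q *
      Real.sin (2 * π * x * (1 - Real.log q / Real.log c))

/-- The pole source (2): `ψ₀(x) = (1/π)∫₀^L 2cosh(y/2) sin(2πx(1 − y/L)) dy`. [cite: Groskin2026, §2.1 eq. (2) (p. 3)] -/
def poleSource (c : ℝ) (x : ℝ) : ℝ :=
  (1 / π) * ∫ y in (0 : ℝ)..Real.log c,
    2 * Real.cosh (y / 2) * Real.sin (2 * π * x * (1 - y / Real.log c))

/-- `S(r,x,L) = ∫₀^L sin(2πx(1 − y/L)) cos(ry) dy` (3). [cite: Groskin2026, §2.1 eq. (3) (p. 3)] -/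
def archKernelS (c : ℝ) (r x : ℝ) : ℝ :=
  ∫ y in (0 : ℝ)..Real.log c, Real.sin (2 * π * x * (1 - y / Real.log c)) * Real.cos (r * y)

/-- The finite-cutoff archimedean source (3): `ψ_{R,T}(x) = (1/2π²)∫_{−T}^{T} h₊(r) S(r,x,L) dr`.
[cite: Groskin2026, §2.1 eq. (3) (p. 3)] -/
def archSource (c T : ℝ) (x : ℝ) : ℝ :=
  (1 / (2 * π ^ 2)) * ∫ r in (-T)..T, hPlus r * archKernelS c r x

/-- `Q_prime^{(c)} := Q_{ψ_p^{(c)}}`. [cite: Groskin2026, §2.1 (p. 4)] -/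
def primeMatrix (c : ℝ) (N : ℕ) : Matrix (idx N) (idx N) ℝ := dividedDiffMatrix (primeSource c) N

/-- `Q_pole := Q_{ψ₀}`. [cite: Groskin2026, §2.1 (p. 4)] -/
def poleMatrix (c : ℝ) (N : ℕ) : Matrix (idx N) (idx N) ℝ := dividedDiffMatrix (poleSource c) N

/-- `Q_arch,T := Q_{ψ_{R,T}}`. [cite: Groskin2026, §2.1 (p. 4)] -/
def archMatrix (c : ℝ) (N : ℕ) (T : ℝ) : Matrix (idx N) (idx N) ℝ :=
  dividedDiffMatrix (archSource c T) N

/-- `Q_arch,∞ := lim_{T→∞} Q_arch,T`, entrywise (`limUnder`; the limit exists by Lemma 2.1, claim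
`lemma_2_1_limit`). [cite: Groskin2026, §2.1 (p. 4)] -/
def archMatrixInfty (c : ℝ) (N : ℕ) : Matrix (idx N) (idx N) ℝ :=
  Matrix.of fun m n ↦ limUnder atTop fun T : ℝ ↦ archMatrix c N T m n

/-- The cutoff-free truncated Weil matrix (4): `Q_∞ := Q_prime + Q_pole + Q_arch,∞`.
[cite: Groskin2026, §2.1 eq. (4) (p. 4)] -/
def cutoffFreeMatrix (c : ℝ) (N : ℕ) : Matrix (idx N) (idx N) ℝ :=
  primeMatrix c N + poleMatrix c N + archMatrixInfty c N

/-- The finite-cutoff total matrix `Q_T^tot := Q_prime + Q_pole + Q_arch,T` (Cor. 3.3).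
[cite: Groskin2026, Corollary 3.3 (p. 11)] -/
def totalMatrix (c : ℝ) (N : ℕ) (T : ℝ) : Matrix (idx N) (idx N) ℝ :=
  primeMatrix c N + poleMatrix c N + archMatrix c N T

/-! ## §2 claims -/

/-- **[Gr26] Lemma 2.1, first clause** (p. 4): the limit defining `Q_arch,∞` exists entrywise
(so `archMatrixInfty` is that limit). The second clause (identification of `Q_∞` with the
Connes–Consani–Moscovici Galerkin matrix `W_{0,2} − W_R − W_p`) is NOT typed. CLAIM.
[claim: Groskin2026, status: under-review] -/
def lemma_2_1_limit : Prop :=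
  ∀ (c : ℝ), 1 < c → ∀ (N : ℕ) (m n : idx N),
    Tendsto (fun T : ℝ ↦ archMatrix c N T m n) atTop (𝓝 (archMatrixInfty c N m n))

/-- **[Gr26] Lemma 2.1, pole matrix in closed form** (proof of Lemma 2.1, p. 4: "which is the pole
matrix of [CCM, Lemma 4.1] verbatim"): with `L = log c`,
`(Q_pole)_{mn} = 32L sinh²(L/4)(L² − 16π²mn)/((L² + 16π²m²)(L² + 16π²n²))`. CLAIM.
[claim: Groskin2026, status: under-review] -/
def lemma_2_1_pole : Prop :=
  ∀ (c : ℝ), 1 < c → ∀ (N : ℕ) (m n : idx N),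
    poleMatrix c N m n =
      32 * Real.log c * Real.sinh (Real.log c / 4) ^ 2 *
          (Real.log c ^ 2 - 16 * π ^ 2 * ((m : ℤ) : ℝ) * ((n : ℤ) : ℝ)) /
        ((Real.log c ^ 2 + 16 * π ^ 2 * ((m : ℤ) : ℝ) ^ 2) *
          (Real.log c ^ 2 + 16 * π ^ 2 * ((n : ℤ) : ℝ) ^ 2))

/-- **[Gr26] Lemma 2.2 (admissibility)** (p. 4): `g_v` is entire, and `g_v(z) = O((1 + |Re z|)⁻²)`
uniformly on every fixed horizontal strip (the support clause `supp ĝ_v ⊆ [−Δ,Δ]` holds by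
definition of `fourierWeight`). CLAIM. [claim: Groskin2026, status: under-review] -/
def lemma_2_2 : Prop :=
  ∀ (c : ℝ), 1 < c → ∀ (N : ℕ) (v : Fin (N + 1) → ℝ),
    Differentiable ℂ (testFunction c N v) ∧
      ∀ a : ℝ, ∃ C : ℝ, ∀ z : ℂ, |z.im| ≤ a → ‖testFunction c N v z‖ ≤ C / (1 + |z.re|) ^ 2

/-- **[Gr26] Lemma 2.3 (finite source calculus)** (p. 5): for the single-frequency source
`ψ_{α,ω}(x) = (α/π) sin(2πωx)`, `⟨v, Q_{α,ω} v⟩ = α K_v(ω)` (in particular `K_v(ω)` is real).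
CLAIM (finite trigonometric identity; not proved here). [claim: Groskin2026, status: under-review] -/
def lemma_2_3 : Prop :=
  ∀ (N : ℕ) (v : Fin (N + 1) → ℝ) (α ω : ℝ),
    ((quadValue N v (dividedDiffMatrix (fun x ↦ α / π * Real.sin (2 * π * ω * x)) N) : ℝ) : ℂ) =
      α * volterraKernel N v ω

/-- **[Gr26] Theorem 2.5 (finite Guinand–Weil dictionary), zero side** (p. 6): for `c > 1`, `N ≥ 0`
and every real `v`, `⟨v, Q_∞ v⟩ = Σ_{z ∈ Z*_ζ} g_v(z)` with multiplicity, `Z*_ζ = {z : ½ + iz is a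
nontrivial zero of ζ}` — an absolutely convergent sum (Lemma 2.2), written as a `HasSum` of
`m(ρ) g_v((ρ − ½)/i)` over the tree's nontrivial zeros `ρ`. CLAIM.
[claim: Groskin2026, status: under-review] -/
def theorem_2_5 : Prop :=
  ∀ (c : ℝ), 1 < c → ∀ (N : ℕ) (v : Fin (N + 1) → ℝ),
    HasSum (fun ρ : ZetaZeros.riemannZetaNontrivialZeros ↦
        (riemannZetaZeroOrder (ρ : ℂ) : ℂ) * testFunction c N v (((ρ : ℂ) - 1 / 2) / I))
      ((quadValue N v (cutoffFreeMatrix c N) : ℝ) : ℂ)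

/-- **[Gr26] Theorem 2.5, explicit-formula side** (p. 6): `⟨v, Q_∞ v⟩ =
−(1/π)Σ_{q=p^a≤c} Λ(q) q^{-1/2} ĝ_v(log q/2π) + 2 g_v(i/2) + (1/2π)∫_ℝ h₊(r) g_v(r) dr`. CLAIM.
[claim: Groskin2026, status: under-review] -/
def theorem_2_5' : Prop :=
  ∀ (c : ℝ), 1 < c → ∀ (N : ℕ) (v : Fin (N + 1) → ℝ),
    ((quadValue N v (cutoffFreeMatrix c N) : ℝ) : ℂ) =
      -(1 / π) * (∑ q ∈ Finset.range (⌊c⌋₊ + 1),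
          ((ArithmeticFunction.vonMangoldt q / Real.sqrt q : ℝ) : ℂ) *
            fourierWeight c N v (Real.log q / (2 * π))) +
        2 * testFunction c N v (I / 2) +
        (1 / (2 * π)) * ∫ r : ℝ, (hPlus r : ℂ) * testFunction c N v r

/-! ## §3 The archimedean tail order -/

/-- `a_T = T/ρ` ([Gr26] §3, p. 8). [cite: Groskin2026, §3 (p. 8)] -/
def aCut (c T : ℝ) : ℝ := T / rho c

/-- `p_T(n) = 1/(a_T − n)` (`n ∈ I_N`, `T > ρN`). [cite: Groskin2026, §3 (p. 8)] -/
def pVec (c : ℝ) (N : ℕ) (T : ℝ) : idx N → ℝ := fun n ↦ 1 / (aCut c T - ((n : ℤ) : ℝ))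

/-- `q_T(n) = 1/(a_T + n)` (`n ∈ I_N`, `T > ρN`). [cite: Groskin2026, §3 (p. 8)] -/
def qVec (c : ℝ) (N : ℕ) (T : ℝ) : idx N → ℝ := fun n ↦ 1 / (aCut c T + ((n : ℤ) : ℝ))

/-- The tail budget `B_T = (1/π²)∫_T^∞ h₊(r) sin²(Lr/2) ρ⁻¹ (‖p_r‖₂² + ‖q_r‖₂²) dr` (Cor. 3.3; the
trace of the positive tail). [cite: Groskin2026, Corollary 3.3 (p. 11)] -/
def tailBudget (c : ℝ) (N : ℕ) (T : ℝ) : ℝ :=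
  (1 / π ^ 2) * ∫ r in Set.Ioi T, hPlus r * Real.sin (Real.log c * r / 2) ^ 2 / rho c *
    (pVec c N r ⬝ᵥ pVec c N r + qVec c N r ⬝ᵥ qVec c N r)

/-- **[Gr26] Lemma 3.1 (the archimedean density)** (p. 9), AS PRINTED: `h₊` is strictly increasing on
`(0,∞)`; for `t > 0`, `h₊′(t) = (t/2) Σ_{k≥0} (k + ¼)/((k + ¼)² + (t/2)²)² ≤ 1/t + 13/(10t²)`; and
`h₊(t) ≤ log t − 8/5` for `t ≥ 7`. (The clause "`h₊(7) = 0.10717967… > 0` (Arb), so `h₊ > 0` on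
`[7,∞)`" is PROVED below in the weaker form `0 < h₊(7)`: `hPlus_seven_pos`, `hPlus_pos_of_seven_le`.)
CLAIM. [claim: Groskin2026, status: under-review] -/
def lemma_3_1 : Prop :=
  StrictMonoOn hPlus (Set.Ioi 0) ∧
    (∀ t : ℝ, 0 < t →
      HasDerivAt hPlus
          (t / 2 * ∑' k : ℕ, ((k : ℝ) + 1 / 4) / (((k : ℝ) + 1 / 4) ^ 2 + (t / 2) ^ 2) ^ 2) t ∧
        t / 2 * ∑' k : ℕ, ((k : ℝ) + 1 / 4) / (((k : ℝ) + 1 / 4) ^ 2 + (t / 2) ^ 2) ^ 2 ≤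
          1 / t + 13 / (10 * t ^ 2)) ∧
    ∀ t : ℝ, 7 ≤ t → hPlus t ≤ Real.log t - 8 / 5

/-- **`h₊(7) > 0` in the kernel** ([Gr26] Lemma 3.1: "Interval evaluation in Arb gives
`h₊(7) = 0.10717967… > 0`"): from ten terms of the vertical series
`Re ψ(¼ + it/2) ≥ ψ(¼) + Σ_{m<10} 2t²/(l_m(l_m² + t²))`, `l_m = 2m + ½` (`sum_digammaTerm_le`) and
`ψ(¼) − log π ≥ −5.37218344` (`re_digamma_one_quarter_sub_log_pi_ge`): the partial sum at `t = 7`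
exceeds `5.41`. PROVED. [cite: Groskin2026, Lemma 3.1 (p. 9)] -/
theorem hPlus_seven_pos : 0 < hPlus 7 := by
  have h1 := sum_digammaTerm_le 10 7
  have h2 := re_digamma_one_quarter_sub_log_pi_ge
  rw [reDigammaQuarter_zero] at h1
  have h3 : (5.41 : ℝ) ≤ ∑ m ∈ Finset.range 10, digammaTerm (digammaNode m) 7 := by
    simp only [digammaTerm, digammaNode, Finset.sum_range_succ, Finset.sum_range_zero]
    norm_num
  unfold hPlus
  linarith

/-- "so `h₊(t) > 0` for `t ≥ 7`" ([Gr26] Lemma 3.1), PROVED from `hPlus_seven_pos` and the tree's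
monotonicity of `Re ψ(¼ + it/2)` in `|t|` (`reDigammaQuarter_mono`). [cite: Groskin2026, Lemma 3.1 (p. 9)] -/
theorem hPlus_pos_of_seven_le {t : ℝ} (ht : 7 ≤ t) : 0 < hPlus t := by
  have hmono : reDigammaQuarter 7 ≤ reDigammaQuarter t :=
    reDigammaQuarter_mono (by rw [abs_of_nonneg (by norm_num : (0:ℝ) ≤ 7), abs_of_nonneg (by linarith)]; exact ht)
  have h7 := hPlus_seven_pos
  unfold hPlus at *
  linarith

/-- `h₊` is (weakly) increasing on `[0,∞)` — the non-strict part of [Gr26] Lemma 3.1's monotonicity,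
PROVED from the tree's `reDigammaQuarter_mono`. [cite: Groskin2026, Lemma 3.1 (p. 9)] -/
theorem hPlus_mono : MonotoneOn hPlus (Set.Ici 0) := by
  intro u hu t ht hut
  have : reDigammaQuarter u ≤ reDigammaQuarter t :=
    reDigammaQuarter_mono (by rw [abs_of_nonneg (show (0:ℝ) ≤ u from hu),
      abs_of_nonneg (show (0:ℝ) ≤ t from ht)]; exact hut)
  unfold hPlus
  linarith

/-- **[Gr26] Theorem 3.2 (archimedean tail order)** (p. 10), AS PRINTED: for
`T₂ > T₁ > max(ρN, 7)`, the increment `Δ_{T₁,T₂} = Q_arch,T₂ − Q_arch,T₁` has the exact rank-two-density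
representation `Δ_{T₁,T₂}(m,n) = (1/π²)∫_{T₁}^{T₂} h₊(T) sin²(LT/2) ρ⁻¹ (p_T(m)p_T(n) + q_T(m)q_T(n)) dT`;
it is positive definite (stated over `ℝ`; equivalent to the printed statement on `ℂ^{I_N}` for a real
symmetric matrix); and every minor with increasing row and column index maps is strictly positive
(strict total positivity in the order `−N < ⋯ < N`). CLAIM. [claim: Groskin2026, status: under-review] -/
def theorem_3_2 : Prop :=
  ∀ (c : ℝ), 1 < c → ∀ (N : ℕ) (T₁ T₂ : ℝ), max (rho c * N) 7 < T₁ → T₁ < T₂ →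
    (∀ m n : idx N, (archMatrix c N T₂ - archMatrix c N T₁) m n =
        (1 / π ^ 2) * ∫ T in T₁..T₂, hPlus T * Real.sin (Real.log c * T / 2) ^ 2 / rho c *
          (pVec c N T m * pVec c N T n + qVec c N T m * qVec c N T n)) ∧
    (archMatrix c N T₂ - archMatrix c N T₁).PosDef ∧
    ∀ (k : ℕ) (r s : Fin k → idx N), StrictMono (fun i ↦ ((r i : ℤ))) →
      StrictMono (fun i ↦ ((s i : ℤ))) → 0 < k →
        0 < ((archMatrix c N T₂ - archMatrix c N T₁).submatrix r s).det

/-- **[Gr26] Corollary 3.3 (i)** (p. 11), in Loewner form: for `T > max(ρN, 7)`,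
`Q_∞ − Q_T^tot ≻ 0` and `Q_∞ − Q_T^tot ⪯ B_T I` (hence, by Weyl monotonicity as printed,
`λ_j(Q_T^tot) < λ_j(Q_∞) ≤ λ_j(Q_T^tot) + B_T` for `1 ≤ j ≤ 2N+1`, and `λ_j(Q_T^tot) ↑ λ_j(Q_∞)`).
CLAIM. [claim: Groskin2026, status: under-review] -/
def corollary_3_3_i : Prop :=
  ∀ (c : ℝ), 1 < c → ∀ (N : ℕ) (T : ℝ), max (rho c * N) 7 < T →
    (cutoffFreeMatrix c N - totalMatrix c N T).PosDef ∧
      (tailBudget c N T • (1 : Matrix (idx N) (idx N) ℝ) -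
        (cutoffFreeMatrix c N - totalMatrix c N T)).PosSemidef

/-- **[Gr26] Corollary 3.3 (ii), first clause** ("`λ_j(Q_T^tot) ≥ 0` certifies `λ_j(Q_∞) > 0`"), in
the form used for certification: if the finite-cutoff matrix is positive semidefinite then the
cutoff-free matrix is positive definite. PROVED from claim (i). [cite: Groskin2026, Corollary 3.3 (ii) (p. 11)] -/
theorem corollary_3_3_certify_pos (h : corollary_3_3_i) {c : ℝ} (hc : 1 < c) {N : ℕ} {T : ℝ}
    (hT : max (rho c * N) 7 < T) (hpsd : (totalMatrix c N T).PosSemidef) :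
    (cutoffFreeMatrix c N).PosDef := by
  have hpd := (h c hc N T hT).1
  have := Matrix.PosDef.posSemidef_add hpsd hpd
  rwa [add_sub_cancel] at this

/-- **[Gr26] Corollary 3.3 (ii), second clause** ("`λ_j(Q_T^tot) < −B_T` certifies `λ_j(Q_∞) < 0`"),
in vector form: a real vector `x` with `xᵗ Q_T^tot x < −B_T ‖x‖²` has `xᵗ Q_∞ x < 0`, so `Q_∞` is not
positive semidefinite. PROVED from claim (i). [cite: Groskin2026, Corollary 3.3 (ii) (p. 11)] -/
theorem corollary_3_3_certify_neg (h : corollary_3_3_i) {c : ℝ} (hc : 1 < c) {N : ℕ} {T : ℝ}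
    (hT : max (rho c * N) 7 < T) {x : idx N → ℝ}
    (hx : x ⬝ᵥ (totalMatrix c N T *ᵥ x) < -(tailBudget c N T * (x ⬝ᵥ x))) :
    x ⬝ᵥ (cutoffFreeMatrix c N *ᵥ x) < 0 := by
  have hle := (h c hc N T hT).2.dotProduct_mulVec_nonneg x
  simp only [star_trivial, Matrix.sub_mulVec, Matrix.smul_mulVec, Matrix.one_mulVec,
    dotProduct_sub, dotProduct_smul, smul_eq_mul] at hle
  linarith

/-- **[Gr26] Corollary 3.3 (iii) (explicit budget)** (p. 11), AS PRINTED: for `N ≥ 1` and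
`T > max(ρN, 7)`, `B_T ≤ (2(2N+1)ρ/π²)(log T/(T − ρN) + (ρN)⁻¹ log(T/(T − ρN)))`; as `T → ∞` with
`(c, N)` fixed, `B_T = ((2N+1)ρ/(π²T))(log(T/2π) + 1)(1 + o(1))`, "in particular `B_{2T}/B_T → ½`".
CLAIM. [claim: Groskin2026, status: under-review] -/
def corollary_3_3_iii : Prop :=
  ∀ (c : ℝ), 1 < c → ∀ (N : ℕ), 1 ≤ N →
    (∀ T : ℝ, max (rho c * N) 7 < T →
      tailBudget c N T ≤
        2 * (2 * N + 1) * rho c / π ^ 2 *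
          (Real.log T / (T - rho c * N) + (rho c * N)⁻¹ * Real.log (T / (T - rho c * N)))) ∧
    Tendsto (fun T : ℝ ↦ tailBudget c N T /
        ((2 * N + 1) * rho c / (π ^ 2 * T) * (Real.log (T / (2 * π)) + 1))) atTop (𝓝 1) ∧
    Tendsto (fun T : ℝ ↦ tailBudget c N (2 * T) / tailBudget c N T) atTop (𝓝 (1 / 2))

end Groskin2026

end Literature.NumberTheory.LFunctions

end
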